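import Mathlib
import HarnessLib
import Summits.ValiantsHypothesis.ValiantsHypothesis.Theorems.MonotoneRestorationOrbitRestorationQPHomPolyClose
import Summits.ValiantsHypothesis.ValiantsHypothesis.Theorems.MonotoneRestorationQP.Negative.LoadBearing
import Literature.Computability.AlgebraicComplexity.DawarWilsenach2025Thm71

/-!
# Route MonotoneRestoration — crux `OrbitRestorationQP` (stmt-ValiantsHypothesis-18293):
# narrow hom-expansions give quasi-polynomial orbits (unconditionally), and the permanent has none

Two unconditional consequences of K2 (`stub_homPoly_close`, PROVED in
`Theorems/MonotoneRestorationOrbitRestorationQPHomPolyClose.lean`) and K3 (`stub_close_orbit`, PROVED in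
`Theorems/MonotoneRestorationOrbitRestorationQPCloseOrbit.lean`) of line `narrow-expansion`:

* `qpOrbit_of_mem_narrowSpan` — the VP-free, symmetry-free engine of the counting-width route: ANY
  family `f_n` lying, for every `n`, in the `ℂ`-span of the homomorphism polynomials of bipartite
  patterns of treewidth `≤ (log₂ n + c)^c` has square-symmetric circuits of orbit size
  `≤ 2^((log₂ n + c + 3)^(c + 3))` (so K1 `NarrowExpansionVP` ⇒ the crux, which is
  `orbitRestorationQP_of_narrowExpansionVP`; here the implication is recorded family by family);
* `perPoly_not_mem_narrowSpan` — **the permanent is not narrowly expandable**: for every `c` there is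
  NO expansion of all `per_n` in patterns of treewidth `≤ (log₂ n + c)^c`; i.e. the unique homomorphism
  expansion of the permanent charges patterns of treewidth `ω(polylog n)` infinitely often.  Proof:
  narrow ⇒ quasi-polynomial orbits (above) versus Dawar–Wilsenach 2025 Thm 7.1 in orbit form
  (`DawarWilsenach2025_thm71_holds`, PROVED in the tree: `2^{ε n} ≤ ORB` infinitely often) and
  `(log₂ n + c)^c < ε n` (`polylog_pow_lt_linear`).  This is the K1-analogue of
  `Negative/OrbitRestorationFalseWithoutVP.lean`: the `VP` hypothesis of K1 is load-bearing (K1 minus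
  `IsVPFamily` fails at the matrix-symmetric family `per`), and it is the calibration of K1's refutation
  instrument ("one family and one wide pattern with a nonzero coefficient beyond every polylog") on the
  one family where the tree can certify it.

VP ≠ VNP is not moved (per ∈ VNP; K1 speaks about VP families).
-/

noncomputable section

-- `Summit.ValiantsHypothesis.ValiantsHypothesis.…` is the tree's single-conjunct layout (Sub = Summit).
set_option linter.dupNamespace false

namespace Summit.ValiantsHypothesis.ValiantsHypothesis.Theorems.OrbitRestorationQPHomPolyClose

open Literature.Computability.AlgebraicComplexity Filter

/-- **Narrow hom-expansions give quasi-polynomial orbits** (no `VP`, no symmetry hypothesis): if every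
`f n` lies in the `ℂ`-span of the homomorphism polynomials of bipartite patterns of treewidth
`≤ (log₂ n + c)^c`, then every `f n` has a square-symmetric labelled circuit of orbit size
`≤ 2^((log₂ n + c + 3)^(c + 3))`.  (K2 turns the span certificate into one labelled pattern expression
with `(log₂ n + c)^c + 1` labels a side, K3 into a circuit; `n = 0` is a constant.) [folklore] -/
theorem qpOrbit_of_mem_narrowSpan (f : (n : ℕ) → MvPolynomial (Fin n × Fin n) ℂ) (c : ℕ)
    (hc : ∀ n : ℕ, f n ∈ Submodule.span ℂ
        {p : MvPolynomial (Fin n × Fin n) ℂ | ∃ (a b : ℕ) (E : Multiset (Fin a × Fin b)),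
          Literature.Combinatorics.SimpleGraph.treewidth
              (SimpleGraph.fromRel fun u v : Fin a ⊕ Fin b =>
                ∃ e ∈ E, u = Sum.inl e.1 ∧ v = Sum.inr e.2) ≤ (Nat.log 2 n + c) ^ c ∧
            p = homPoly E n ℂ}) (n : ℕ) :
    ∃ (G : Type) (_ : Fintype G) (C : LabelledArithCircuit ℂ (Fin n × Fin n) Unit G),
      C.IsSymmetric (Equiv.Perm (Fin n)) ∧ C.eval (C.output ()) = f n ∧
        C.orbitSize (Equiv.Perm (Fin n)) ≤ 2 ^ ((Nat.log 2 n + (c + 3)) ^ (c + 3)) := by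
  rcases Nat.eq_zero_or_pos n with rfl | hn
  · -- `n = 0`: no variables, `f 0` is the constant `coeff 0 (f 0)`
    obtain ⟨G, inst, C, hC, hev, horb⟩ :=
      stub_close_orbit 0 0 0 (PatternExpr.const (MvPolynomial.coeff 0 (f 0)))
    refine ⟨G, inst, C, hC, ?_, horb.trans (le_trans (by norm_num) Nat.one_le_two_pow)⟩
    rw [hev, narrowExpansion_close_const]
    exact (MvPolynomial.eq_C_of_isEmpty (f 0)).symm
  · -- `n ≥ 1`: span certificate → one expression with `W = (log₂ n + c)^c + 1` labels a side → circuit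
    obtain ⟨e, he⟩ :=
      narrowExpansion_exists_expr stub_homPoly_close n ((Nat.log 2 n + c) ^ c) hn (f n) (hc n)
    obtain ⟨G, inst, C, hC, hev, horb⟩ :=
      stub_close_orbit n ((Nat.log 2 n + c) ^ c + 1) ((Nat.log 2 n + c) ^ c + 1) e
    exact ⟨G, inst, C, hC, by rw [hev, he], horb.trans (narrowExpansion_orbit_bound n c)⟩

/-- **The permanent is not narrowly expandable**: for no constant `c` does every `per_n` lie in the
`ℂ`-span of the homomorphism polynomials of bipartite patterns of treewidth `≤ (log₂ n + c)^c` — the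
homomorphism expansion of the permanent charges patterns of super-polylogarithmic treewidth infinitely
often.  Narrow ⇒ orbits `≤ 2^((log₂ n + c + 3)^(c+3))` (`qpOrbit_of_mem_narrowSpan`) versus
Dawar–Wilsenach 2025 Thm 7.1 (orbit form, proved in the tree).
[cite: DawarWilsenach2025, Thm. 7.1 (p. 18)] -/
theorem perPoly_not_mem_narrowSpan (c : ℕ) :
    ¬ ∀ n : ℕ, perPoly (Fin n) ℂ ∈ Submodule.span ℂ
        {p : MvPolynomial (Fin n × Fin n) ℂ | ∃ (a b : ℕ) (E : Multiset (Fin a × Fin b)),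
          Literature.Combinatorics.SimpleGraph.treewidth
              (SimpleGraph.fromRel fun u v : Fin a ⊕ Fin b =>
                ∃ e ∈ E, u = Sum.inl e.1 ∧ v = Sum.inr e.2) ≤ (Nat.log 2 n + c) ^ c ∧
            p = homPoly E n ℂ} := by
  intro h
  have hc := qpOrbit_of_mem_narrowSpan (fun n => perPoly (Fin n) ℂ) c h
  choose G inst C hCsymm hCeval hCorb using hc
  obtain ⟨ε, hε, hfreq⟩ := @DawarWilsenach2025_thm71_holds ℂ _ _ G inst C hCsymm hCeval
  obtain ⟨n₀, key⟩ := MonotoneRestorationQP.Negative.polylog_pow_lt_linear (c + 3) hε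
  obtain ⟨n, hle, hn⟩ := (hfreq.and_eventually (eventually_ge_atTop n₀)).exists
  have horb : (((C n).orbitSize (Equiv.Perm (Fin n)) : ℕ) : ℝ) ≤
      (2 : ℝ) ^ (((Nat.log 2 n + (c + 3)) ^ (c + 3) : ℕ) : ℝ) := by
    rw [Real.rpow_natCast]
    exact_mod_cast hCorb n
  have hlt : (2 : ℝ) ^ (((Nat.log 2 n + (c + 3)) ^ (c + 3) : ℕ) : ℝ) < (2 : ℝ) ^ (ε * n) := by
    apply (Real.rpow_lt_rpow_left_iff one_lt_two).2
    have := key n hn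
    push_cast at this ⊢
    exact this
  exact absurd (hle.trans horb) (not_le.mpr hlt)

/-- The same, packaged: **K1 without its `VP` hypothesis is false** — "every matrix-symmetric family
lies, for one constant `c` and every `n`, in the narrow span" fails at the permanent (which is
matrix-symmetric); so the `VP` hypothesis of `NarrowExpansionVP` is load-bearing, exactly as for the
crux itself (`Negative/OrbitRestorationFalseWithoutVP.lean`). [cite: DawarWilsenach2025, Thm. 7.1 (p. 18)] -/
theorem narrowExpansion_false_without_VP :
    ¬ (∀ f : (n : ℕ) → MvPolynomial (Fin n × Fin n) ℂ,
      (∀ (n : ℕ) (σ τ : Equiv.Perm (Fin n)),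
        MvPolynomial.rename (fun p : Fin n × Fin n => (σ p.1, τ p.2)) (f n) = f n) →
      ∃ c : ℕ, ∀ n : ℕ, f n ∈ Submodule.span ℂ
        {p : MvPolynomial (Fin n × Fin n) ℂ | ∃ (a b : ℕ) (E : Multiset (Fin a × Fin b)),
          Literature.Combinatorics.SimpleGraph.treewidth
              (SimpleGraph.fromRel fun u v : Fin a ⊕ Fin b =>
                ∃ e ∈ E, u = Sum.inl e.1 ∧ v = Sum.inr e.2) ≤ (Nat.log 2 n + c) ^ c ∧
            p = homPoly E n ℂ}) := by
  intro h
  have hsymm : ∀ (n : ℕ) (σ τ : Equiv.Perm (Fin n)),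
      MvPolynomial.rename (fun p : Fin n × Fin n => (σ p.1, τ p.2)) (perPoly (Fin n) ℂ) =
        perPoly (Fin n) ℂ := by
    intro n σ τ
    have h' := congrArg (MvPolynomial.map (Complex.ofRealHom.comp NNReal.toRealHom))
      (MonotoneRestorationQP.Negative.rename_perm_perPoly n σ τ)
    rw [MvPolynomial.map_rename, map_perPoly] at h'
    exact h'
  obtain ⟨c, hc⟩ := h (fun n => perPoly (Fin n) ℂ) hsymm
  exact perPoly_not_mem_narrowSpan c hc

end Summit.ValiantsHypothesis.ValiantsHypothesis.Theorems.OrbitRestorationQPHomPolyClose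

end
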